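import Summits.Ventures.CertifiedArithmetic.LowPrec.GemmEnvelopeOnsetPairs

/-!
# GEMM-level envelopes, part (aa): THE OUTPUT-LEVEL ONSET OF ROW P5 FOR BLOCKS OF LENGTH 2 IS EXACTLY `onset₂` (pub-lowprec gemm gen 24, LXXII-c)

HONEST FRAMING: certified error envelopes and provably optimal rounding/accumulation schemes for
low-precision formats under stated cost models; every table by two implementations; no hardware or vendor
claims.

Row P5 (MX-E4M3-ceil against `C_Π = 35/289 + (γ̄ + δ̄(1 + γ̄))·324/289`) at the OUTPUT of the pipeline, blocks
of LENGTH 2.  The best separating cell is max·sliver (the one-sided mask `(M, v)·(0, w)` of part (h)), ratio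
`(18/17)·ρ_sl` with `ρ_sl < κ/14336` on the first sliver rung (`v ↦ X/64`) and `ρ_sl < κ/16384` on the second
(`v ↦ 7X/512`); so — unlike the quadratic `κ_Π` of blocks `≥ 3` (parts (u), (v)) — the onset for `k = 2` is
LINEAR in `κ` and sits on the SECOND rung:

  `onset₂(γ̄, δ̄; C) = 16384·(17/18)·(1 + C)/((1 - γ̄)(1 - δ̄))`,  `= 608995584/34799 ≈ 17500.376` at the caps
  of record `(1/2048, 1/257)` and `C_Π` (`= 16384·(17/18)·R_Π²`; inside `(229376/15, 229376/13)`).  (This is the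
  onset whenever the first-rung value `14336·(17/18)·(1 + C)/((1 - γ̄)(1 - δ̄))` exceeds the rung end `229376/15`, as
  at the caps of record; at `(γ̄, δ̄) = (0, 0)` that value is `θ = 258048/17` itself and the onset sits on the first
  rung — part (h).  The theorems below are stated so as to hold at every caps; only sharpness is caps-dependent.)

* Part (z) `GemmEnvelopeOnsetTwoBand` proved the no-witness half: `row_P5_two_no_output_witness_below` — for
  every `κ` with `34799·κ ≤ 608995584` NO input of `C(κ)` with MX blocks of length 2 is an output-level witness
  of `¬(MXC ≼ VEC)`, every `B`.  (This file imports only part (y); the two halves are independent.)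
* `row_P5_two_output_witness` (generic caps `0 ≤ γ̄ < 1`, `0 ≤ δ̄ < 1`, `C ≥ 0`, onset
  `(139264/9)(1 + C) < (1 - γ̄)(1 - δ̄)κ`, second-rung condition `221(1 + C) < 252(1 - γ̄)(1 - δ̄)`): the
  one-sided mask `(M, v)·(0, w)`, `max(224/κ, 13/1024) < v < 15/1024`, `272 < w ≤ 288`, `M = min(κv, 448)`,
  separates for EVERY realisation; `row_P5_two_output_onset_above`: the instance — for EVERY `κ` with
  `608995584 < 34799·κ`, every `B > 0` (no upper bound on `κ`).
* So the output-level onset of row P5 for blocks of length 2 is EXACTLY `onset₂`; with parts (v) (length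
  `≥ 3`: `κ_Π`) and (z) (length 1: never) row P5 is decided at the output level for every block length and
  every `κ` at the caps of record.  Cert (two implementations): `certs/gemm/GEMM-ENVELOPES-ONSET2.json`.

Exact rational algebra over the kernel definitions; caps are hypotheses, not device claims.  No `sorry`;
axioms `propext`, `Classical.choice`, `Quot.sound` only.  [cite: RouhaniEtAl2023MX, §5.1]
[cite: MicikeviciusEtAl2022, §3] [cite: Higham2002ASNA, §3.1]
-/

namespace Summit.Ventures.CertifiedArithmetic.LowPrec.GemmEnvelope

open Finset
open Literature.ComputerArithmetic.FloatingPoint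
open Literature.ComputerArithmetic.FloatingPoint.Format
open Literature.ComputerArithmetic.FloatingPoint.MiniFloat
open Literature.ComputerArithmetic.FloatingPoint.MXBlock
open Summit.Ventures.CertifiedArithmetic.LowPrec.SR

/-! ## Row P5, blocks of length 2: the witness half above `onset₂` -/

/-- **ROW P5, LENGTH 2, OUTPUT-LEVEL WITNESS ABOVE THE ONSET (generic caps and constant).**  Caps
`0 ≤ γ̄ < 1`, `0 ≤ δ̄ < 1`, constant `C ≥ 0`; if `(139264/9)·(1 + C) < (1 - γ̄)(1 - δ̄)·κ` (`κ > onset₂(γ̄, δ̄; C)`)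
and the onset sits on the second sliver rung, `221·(1 + C) < 252·(1 - γ̄)(1 - δ̄)` (i.e.
`(1 + C)/((1 - γ̄)(1 - δ̄)) < 252/221 = (14/13)·(18/17)`, equivalently `onset₂(γ̄, δ̄; C) < 229376/13`, the end of
the second rung), then the one-sided masked MX block pair `a = (M, v)`, `b = (0, w)` with
`max(224/κ, 13/1024) < v < 15/1024` (`v ↦ 7/512`), `272 < w ≤ 288` (`w ↦ 288`), `M = min(κv, 448)` (scales `1`)
lies in `C(κ)` and has `C·L < |c - S|` for EVERY realisation: the only nonzero quantised cell is
`(7/512)·288 = 63/16` against the exact `v·w`. [cite: RouhaniEtAl2023MX, §5.1] [cite: Higham2002ASNA, §3.1] -/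
theorem row_P5_two_output_witness {B : ℕ} (hB : 0 < B) {κ γb δb C : ℚ}
    (hγb0 : 0 ≤ γb) (hγb : γb < 1) (hδb0 : 0 ≤ δb) (hδb : δb < 1) (hC : 0 ≤ C)
    (honset : 139264 / 9 * (1 + C) < (1 - γb) * (1 - δb) * κ)
    (hrung : 221 * (1 + C) < 252 * ((1 - γb) * (1 - δb))) :
    ∃ (a b : Fin B → Fin 2 → ℚ) (Aa Ab : ℚ),
      (∀ j i, |a j i| ≤ Aa ∧ (a j i = 0 ∨ Aa ≤ κ * |a j i|)) ∧
      (∀ j i, |b j i| ≤ Ab ∧ (b j i = 0 ∨ Ab ≤ κ * |b j i|)) ∧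
      ∀ (γ δ acc c : ℚ), γ ≤ γb → δ ≤ δb →
        |acc - ∑ j, ∑ i, (ceilScale E4M3 (a j) * (roundNE E4M3 (a j i / ceilScale E4M3 (a j))).toRat) *
            (ceilScale E4M3 (b j) * (roundNE E4M3 (b j i / ceilScale E4M3 (b j))).toRat)|
          ≤ γ * ∑ j, ∑ i, |(ceilScale E4M3 (a j) * (roundNE E4M3 (a j i / ceilScale E4M3 (a j))).toRat) *
            (ceilScale E4M3 (b j) * (roundNE E4M3 (b j i / ceilScale E4M3 (b j))).toRat)| →
        |c - acc| ≤ δ * |acc| →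
        C * ∑ j, ∑ i, |a j i * b j i| < |c - ∑ j, ∑ i, a j i * b j i| := by
  have hM0 : 0 < E4M3.maxRat := by rw [e4m3_envelope_constants.2.2.2.2.2.1]; norm_num
  have hC1 : 0 < 1 + C := by linarith
  have hlam0 : 0 < (1 - γb) * (1 - δb) := mul_pos (by linarith) (by linarith)
  have hlam1 : (1 - γb) * (1 - δb) ≤ 1 := by nlinarith
  have hκ0 : 0 < κ := by
    by_contra h
    push Not at h
    have h1 : (1 - γb) * (1 - δb) * κ ≤ 0 := mul_nonpos_of_nonneg_of_nonpos hlam0.le h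
    nlinarith
  have hκlam : (1 - γb) * (1 - δb) * κ ≤ κ := by nlinarith
  have hκ1 : 1 ≤ κ := by nlinarith
  -- the cell value `v` on the second rung: `max(224/κ, 13/1024) < v < 15/1024`, `(1 + C)·272·v < λ·63/16`
  obtain ⟨v, hv13, hv15, hκv, hvC⟩ : ∃ v : ℚ, 13 / 1024 < v ∧ v < 15 / 1024 ∧ 224 < κ * v ∧
      (1 + C) * v * 272 < (1 - γb) * (1 - δb) * (63 / 16) := by
    have hden : 0 < (1 + C) * 272 := by positivity
    have hm_vstar : max (224 / κ) (13 / 1024) < (1 - γb) * (1 - δb) * (63 / 16) / ((1 + C) * 272) := by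
      rw [lt_div_iff₀ hden]
      rcases le_total (224 / κ) (13 / 1024) with h | h
      · rw [max_eq_right h]; linarith
      · rw [max_eq_left h, div_mul_eq_mul_div, div_lt_iff₀ hκ0]; linarith
    have hm15 : max (224 / κ) (13 / 1024) < 15 / 1024 := by
      refine max_lt ?_ (by norm_num)
      rw [div_lt_iff₀ hκ0]; nlinarith
    have hmin := lt_min hm15 hm_vstar
    refine ⟨(max (224 / κ) (13 / 1024) + min (15 / 1024) ((1 - γb) * (1 - δb) * (63 / 16) / ((1 + C) * 272)))
      / 2, ?_, ?_, ?_, ?_⟩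
    · have := le_max_right (224 / κ) (13 / 1024); linarith
    · have := min_le_left (15 / 1024 : ℚ) ((1 - γb) * (1 - δb) * (63 / 16) / ((1 + C) * 272)); linarith
    · have h1 := le_max_left (224 / κ) (13 / 1024)
      rw [div_le_iff₀ hκ0] at h1
      have h2 : κ * max (224 / κ) (13 / 1024) < κ * ((max (224 / κ) (13 / 1024) +
          min (15 / 1024) ((1 - γb) * (1 - δb) * (63 / 16) / ((1 + C) * 272))) / 2) :=
        mul_lt_mul_of_pos_left (by linarith) hκ0
      linarith
    · have h1 := min_le_right (15 / 1024 : ℚ) ((1 - γb) * (1 - δb) * (63 / 16) / ((1 + C) * 272))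
      have h2 : (max (224 / κ) (13 / 1024) + min (15 / 1024) ((1 - γb) * (1 - δb) * (63 / 16) /
          ((1 + C) * 272))) / 2 < (1 - γb) * (1 - δb) * (63 / 16) / ((1 + C) * 272) := by linarith
      rw [lt_div_iff₀ hden] at h2
      linarith
  have hv0 : 0 < v := by linarith
  -- the second element of `b`: `272 < w ≤ 288` (`w ↦ 288`), close enough to `272` for the strict inequality
  obtain ⟨w, hw272, hw288, hnum⟩ : ∃ w : ℚ, 272 < w ∧ w ≤ 288 ∧
      (C + 1) * (v * w) < (1 - γb) * (1 - δb) * (7 / 512 * 288) := by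
    have hgap : 0 < (1 - γb) * (1 - δb) * (63 / 16) - (1 + C) * v * 272 := by linarith
    have hden2 : 0 < 2 * ((1 + C) * v) := by positivity
    have hμ0 : 0 < min 16 (((1 - γb) * (1 - δb) * (63 / 16) - (1 + C) * v * 272) / (2 * ((1 + C) * v))) :=
      lt_min (by norm_num) (div_pos hgap hden2)
    have hμ16 := min_le_left (16 : ℚ)
      (((1 - γb) * (1 - δb) * (63 / 16) - (1 + C) * v * 272) / (2 * ((1 + C) * v)))
    have hμgap := min_le_right (16 : ℚ)
      (((1 - γb) * (1 - δb) * (63 / 16) - (1 + C) * v * 272) / (2 * ((1 + C) * v)))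
    rw [le_div_iff₀ hden2] at hμgap
    refine ⟨272 + min 16 (((1 - γb) * (1 - δb) * (63 / 16) - (1 + C) * v * 272) / (2 * ((1 + C) * v))),
      by linarith, by linarith, ?_⟩
    have e : ∀ μ : ℚ, (C + 1) * (v * (272 + μ)) = (1 + C) * v * 272 + μ * ((1 + C) * v) := by
      intro μ; ring
    rw [e]
    nlinarith
  have hw0 : 0 < w := by linarith
  -- the numerator `M = min(κ v, 448)`
  obtain ⟨M, hM224, hM448, hMκ⟩ : ∃ M : ℚ, 224 < M ∧ M ≤ 448 ∧ M ≤ κ * v :=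
    ⟨min (κ * v) 448, lt_min hκv (by norm_num), min_le_right _ _, min_le_left _ _⟩
  have hMpos : 0 < M := by linarith
  have hvM : v ≤ M := by linarith
  have hκM : M ≤ κ * M := by nlinarith
  have hκw : w ≤ κ * w := by nlinarith
  -- rounding facts
  have h7 : (roundNE E4M3 v).toRat = 7 / 512 := toRat_roundNE_E4M3_eq_7_512 hv13 hv15
  have h288 : (roundNE E4M3 w).toRat = 288 := toRat_roundNE_E4M3_eq_288 hw272 hw288
  -- the blocks
  set a' : Fin 2 → ℚ := Fin.cases M (fun _ : Fin 1 => v) with ha'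
  set b' : Fin 2 → ℚ := Fin.cases (0 : ℚ) (fun _ : Fin 1 => w) with hb'
  have ha0 : a' 0 = M := rfl
  have ha1 : a' 1 = v := rfl
  have hb0 : b' 0 = 0 := rfl
  have hb1 : b' 1 = w := rfl
  have haM : ∀ i, |a' i| ≤ M := by
    refine Fin.forall_fin_two.mpr ⟨?_, ?_⟩
    · rw [ha0, abs_of_pos hMpos]
    · rw [ha1, abs_of_pos hv0]; exact hvM
  have hbw : ∀ i, |b' i| ≤ w := by
    refine Fin.forall_fin_two.mpr ⟨?_, ?_⟩
    · rw [hb0, abs_zero]; exact hw0.le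
    · rw [hb1, abs_of_pos hw0]
  have hmemA : ∀ (j : Fin B) (i : Fin 2), |(fun _ : Fin B => a') j i| ≤ M ∧
      ((fun _ : Fin B => a') j i = 0 ∨ M ≤ κ * |(fun _ : Fin B => a') j i|) := by
    intro j i; refine ⟨haM i, ?_⟩
    show a' i = 0 ∨ M ≤ κ * |a' i|
    revert i
    refine Fin.forall_fin_two.mpr ⟨?_, ?_⟩
    · rw [ha0, abs_of_pos hMpos]; exact Or.inr hκM
    · rw [ha1, abs_of_pos hv0]; exact Or.inr hMκ
  have hmemB : ∀ (j : Fin B) (i : Fin 2), |(fun _ : Fin B => b') j i| ≤ w ∧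
      ((fun _ : Fin B => b') j i = 0 ∨ w ≤ κ * |(fun _ : Fin B => b') j i|) := by
    intro j i; refine ⟨hbw i, ?_⟩
    show b' i = 0 ∨ w ≤ κ * |b' i|
    revert i
    refine Fin.forall_fin_two.mpr ⟨Or.inl hb0, ?_⟩
    rw [hb1, abs_of_pos hw0]; exact Or.inr hκw
  -- scales
  have hXa : ceilScale E4M3 a' = 1 := by
    have hBM : blockMax a' = M := blockMax_eq_of_forall_le haM (i₀ := 0) (by rw [ha0, abs_of_pos hMpos])
    have h := ceilScale_eq_zpow hM0 (V := a') (e := 0)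
      (by rw [hBM, e4m3_envelope_constants.2.2.2.2.2.1]; norm_num; linarith)
      (by rw [hBM, e4m3_envelope_constants.2.2.2.2.2.1]; norm_num; linarith)
    simpa using h
  have hXb : ceilScale E4M3 b' = 1 := by
    have hBM : blockMax b' = w := blockMax_eq_of_forall_le hbw (i₀ := 1) (by rw [hb1, abs_of_pos hw0])
    have h := ceilScale_eq_zpow hM0 (V := b') (e := 0)
      (by rw [hBM, e4m3_envelope_constants.2.2.2.2.2.1]; norm_num; linarith)
      (by rw [hBM, e4m3_envelope_constants.2.2.2.2.2.1]; norm_num; linarith)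
    simpa using h
  -- the block sums
  have hS1 : ∑ i, (roundNE E4M3 (a' i)).toRat * (roundNE E4M3 (b' i)).toRat = 7 / 512 * 288 := by
    rw [Fin.sum_univ_two, ha0, ha1, hb0, hb1, h7, h288, toRat_roundNE_zero]; ring
  have hS1a : ∑ i, |(roundNE E4M3 (a' i)).toRat * (roundNE E4M3 (b' i)).toRat| = |(7 : ℚ) / 512 * 288| := by
    rw [Fin.sum_univ_two, ha0, ha1, hb0, hb1, h7, h288, toRat_roundNE_zero, mul_zero, abs_zero, zero_add]
  have hS2 : ∑ i, a' i * b' i = v * w := by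
    rw [Fin.sum_univ_two, ha0, ha1, hb0, hb1]; ring
  have hS3 : ∑ i, |a' i * b' i| = |v * w| := by
    rw [Fin.sum_univ_two, ha0, ha1, hb0, hb1, mul_zero, abs_zero, zero_add]
  refine ⟨fun _ => a', fun _ => b', M, w, hmemA, hmemB, ?_⟩
  intro γ δ acc c hγ hδ hacc hc
  simp only [hXa, hXb, div_one, one_mul, hS1, hS1a, hS2, hS3, sum_const, card_univ, Fintype.card_fin,
    nsmul_eq_mul] at hacc ⊢
  have hN : (0 : ℚ) < (B : ℚ) := by exact_mod_cast hB
  exact pipeline_witness_up_of_caps hN (by norm_num) (mul_pos hv0 hw0) hγb hδb hγ hδ hacc hc hnum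

/-- **ROW P5, LENGTH 2, ABOVE THE ONSET `onset₂` (for EVERY `κ > onset₂`).**  At the caps `(1/2048, 1/257)` and
`C_Π`: for every `κ` with `608995584 < 34799·κ` and every `B > 0` an input of `C(κ)` with MX blocks of length 2
has `C_Π·L < |c - S|` for EVERY realisation.  With `row_P5_two_no_output_witness_below`: the output-level
onset of row P5 for blocks of length 2 is EXACTLY `onset₂ = 608995584/34799 = 16384·(17/18)·R_Π² ≈ 17500.376`
(blocks of length `≥ 3`: `κ_Π ≈ 15245.92`, part (v); length 1: never, below).
[cite: RouhaniEtAl2023MX, §5.1] [cite: MicikeviciusEtAl2022, §3] -/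
theorem row_P5_two_output_onset_above {B : ℕ} (hB : 0 < B) {κ : ℚ} (hκ : 608995584 < 34799 * κ) :
    ∃ (a b : Fin B → Fin 2 → ℚ) (Aa Ab : ℚ),
      (∀ j i, |a j i| ≤ Aa ∧ (a j i = 0 ∨ Aa ≤ κ * |a j i|)) ∧
      (∀ j i, |b j i| ≤ Ab ∧ (b j i = 0 ∨ Ab ≤ κ * |b j i|)) ∧
      ∀ (γ δ acc c : ℚ), γ ≤ 1 / 2048 → δ ≤ 1 / 257 →
        |acc - ∑ j, ∑ i, (ceilScale E4M3 (a j) * (roundNE E4M3 (a j i / ceilScale E4M3 (a j))).toRat) *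
            (ceilScale E4M3 (b j) * (roundNE E4M3 (b j i / ceilScale E4M3 (b j))).toRat)|
          ≤ γ * ∑ j, ∑ i, |(ceilScale E4M3 (a j) * (roundNE E4M3 (a j i / ceilScale E4M3 (a j))).toRat) *
            (ceilScale E4M3 (b j) * (roundNE E4M3 (b j i / ceilScale E4M3 (b j))).toRat)| →
        |c - acc| ≤ δ * |acc| →
        (35 / 289 + 1 / 2048 * (324 / 289) + 1 / 257 * (324 / 289) * (1 + 1 / 2048))
            * ∑ j, ∑ i, |a j i * b j i| < |c - ∑ j, ∑ i, a j i * b j i| :=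
  row_P5_two_output_witness hB (by norm_num) (by norm_num) (by norm_num) (by norm_num) (by norm_num)
    (by linarith) (by norm_num)

end Summit.Ventures.CertifiedArithmetic.LowPrec.GemmEnvelope
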